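import Literature.NumberTheory.EllipticCurves.KellerYin2024.AnomalousLambdaInvariants
import HarnessLib

/-!
# Hida, Ann. of Math. 172 (2010), Theorem I: the `μ`-invariant of the ANTICYCLOTOMIC branch of the
# Katz `p`-adic `L`-function vanishes — for the base change `θ_K` of a `p`-unramified Dirichlet
# character of split conductor over an imaginary quadratic `K` (the input "Hida 2010 `μ = 0`" of
# Castella–Grossi–Lee–Skinner 2022 Thms. 1.2.2 / 2.2.2 and of Keller–Yin 2024 Thm. 1.2.2), as ONE
# named fact over the tree's Katz frame `IsKatzLFunction`

H. Hida, *The Iwasawa `μ`-invariant of `p`-adic Hecke `L`-functions*, Ann. of Math. **172** (2010)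
41–137 (bib `Hida2010MuInvariant`; NOT the key `Hida2010`, a different paper), text of record =
the Annals OA PDF (`paper:hida2010-iwasawa-invariant-ofp-adic-heckel-functions`, PDF page n = printed
p. 39 + n; cell `bsd-eis` LIT-DOSSIER §17 (a) holds the reconstructed displays). SETTING (p. 42):
`F` totally real, `M/F` a totally imaginary quadratic extension, `p` with "(ord) every prime factor
of `p` in `F` splits in `M`"; `C` an `𝓞_M`-ideal prime to `p`, decomposed (p. 43) "`C = 𝔉𝔉_c ℑ` so
that `𝔉𝔉_c` consists of split primes over `F`, `ℑ` consists of inert or ramified primes over `F`";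
`φ` = the Katz–Hida–Tilouine measure on the ray class group `Z(C)` modulo `Cp^∞` (p. 44, (1.3));
`Δ` = the maximal torsion subgroup of `Z(C)`, "a character `ψ : Δ → W^×` is called a branch
character. We fix a splitting `Z(C) = Γ × Δ` … The `ψ`-branch `φ_ψ` of the measure `φ` is defined
on `Γ` and is given by `∫_Γ ϕ dφ_ψ = ∫_{Z(C)} ϕψ dφ` … We write `Γ⁻` for the projection of `Γ` onto
[the part] on which the generator `c ∈ Gal(M/F)` acts by `−1` … `φ⁻_ψ = π⁻_* φ_ψ`" (p. 44);
condition (V) (p. 45): "`ψ̃ ≡ ψ mod 𝔪_W` and `ψ N(𝔠^{-1})W′(ψ) ≡ −1 mod 𝔪_W`. If (V) is satisfied,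
the `μ`-invariant of the measure `φ⁻_ψ` is positive."

**THEOREM I** (p. 45 = PDF p0006 L45–49, verbatim): "Suppose that `p > 2` and that `p` is
unramified in `F/ℚ`. Further suppose that `ℑ = 1`. Then the `μ`-invariant of `φ⁻_ψ` vanishes,
unless (V) is satisfied. When (V) is satisfied, `μ(φ⁻_ψ)` is finite and positive." Followed by:
"The condition (V) is rarely satisfied because it is equivalent to the following three conditions
(see Lemma 5.2): (M1) `M/F` is unramified at every finite place; (M2) …; (M3) …". FOR `F = ℚ`,
`M = K` imaginary quadratic, (M1) FAILS (`K/ℚ` is ramified at the primes dividing `D_K ≠ 1`), so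
(V) fails and the vanishing is UNCONDITIONAL: `μ(φ⁻_ψ) = 0` for every branch character `ψ` of
every `C` prime to `p` all of whose prime factors lie over primes SPLIT in `K` (`ℑ = 1`), `p` odd
("`p` unramified in `F = ℚ`" is empty). [For imaginary quadratic `K` the same vanishing without
`ℑ = 1` is Finis, J. reine angew. Math. 596 (2006) — Hida p. 46.] PUBLISHED / REFEREED.

THE OBJECT IN CGLS / KY. Castella–Grossi–Lee–Skinner 2022 use exactly this theorem for their
anticyclotomic Katz `p`-adic `L`-functions `𝓛_θ` of Thm. 2.1.2 (`θ` a Dirichlet character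
`G_ℚ → ℤ_p^×` of conductor `C ∣ N`, `p ∤ C`, every `ℓ ∣ C` split in `K`; `𝓛_θ = π_θ(Katz measure)`,
`π_θ : g ↦ θ(g)[g]_Γ`, `Γ` the anticyclotomic `ℤ_p`-extension — i.e. the `θ_K`-BRANCH of the measure
on `Z(𝔠𝔠̄)` pushed to `Γ⁻`: `θ_K = θ ∘ Nm` has order prime to `p`, hence kills every `ℤ_p`-free part
and IS a branch character; `C_Hida = 𝔠𝔠̄`, `𝔉 = 𝔠`, `𝔉_c = 𝔠̄`, `ℑ = 1`): proof of Thm. 1.2.2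
(arXiv:2008.02571v2 TeX L646–648) "the works of Rubin … and Hida [hidamu=0], proving the vanishing of
the `μ`-invariant of such anticyclotomic `p`-adic `L`-functions", and proof of Thm. 2.2.2 (L1132) "the
conductors of both `φ` and `ψ` are only divisible by primes split in `K`, and hence the vanishing of
`μ(𝓛_E)` follows immediately from the congruence of Theorem 2.2.1 and Hida's result [hidamu=0]".
Keller–Yin arXiv:2402.12781v2 Thm. 1.2.2 (`Rubin Hida`, L676–683) cite it the same way. So the
identification "CGLS's `𝓛_θ` = Hida's `φ⁻_{θ_K}`" is PRINTED USAGE (CGLS), not this file's inference.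

TRANSCRIPTION. Data = those of the existence fact `CastellaGrossiLeeSkinner2022.thm212_exists_isKatzLFunction`
(this directory's sibling `CastellaGrossiLeeSkinner2022/KatzPAdicLFunctionExistence.lean`), binder
for binder: `p` odd; `K` imaginary quadratic, `p = v v̄` split, `D_K` odd `≠ −3` (CGLS §2 standing);
`v` cut out by `ι` and induced by `ι'`; `κ` anticyclotomic with generator `γ`; `θ : G_ℚ → GL₁(ℤ_p)`
Teichmüller-valued (`θ^{p−1} = 1`), unramified outside a Heegner integer `C` (every prime of `C`
split in `K` — Hida's `ℑ = 1`) and AT `p` (`p ∤ C`); `θ_K` via `IsHeckeCharOf` (arithmetic); `Cbar`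
any finite set of places where `θ_K` ramifies (the frame's away-factors are then `1`). "`μ = 0`" of
`L ∈ R₀⟦T⟧` ↦ `∃ n, FirstUnitCoeffAt L n` (some coefficient is a unit of `R₀ = W(𝔽̄_p)` and all
earlier ones are not: Weierstrass, `KellerYin2024.FirstUnitCoeffAt`). The conclusion is stated for
EVERY Katz frame `(Ω_K ≠ 0, Ω_p ∈ R₀^×, L)` with `IsKatzLFunction ι' v v̄ Cbar κ γ θ_K Ω_K Ω_p L`
(the CORRECTED frame, p429320: Hecke `L`-value at `s = 1`) — the device by which every frame-based
statement of the tree is phrased (`X1.KellerYinMuLambdaSplit.CharMainConjOnTree`: "every Katz frame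
`L` of `θ_K` … the first unit coefficient of `L` exists"; `KellerYin2024.thm222_anacong_goodLattice_*`;
`X1/KellerYinIMC2Halves` for BDP frames). Print speaks of THE measure `φ⁻_ψ`; two frames of the same
`θ_K` with unit `Ω_p` either differ by a unit `u₀(1+T)^s` of `R₀⟦T⟧` (then `μ` agrees) or no second
frame exists (the `n`-dependence `(Ω_p'/Ω_p)^{2n}·ι'^{-1}((Ω_K/Ω_K')^{2n})` of the prescribed values
is interpolable by a bounded series only in that case) — recorded here as the reason the ∀-frame
form says no more than print; nothing about frame rigidity is asserted as a separate statement.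

Consumer: the `μ`-half "`∃ m, FirstUnitCoeffAt L m`" of the cell's `[BR𝟙]`
(`X1.KellerYinMuLambdaSplit.CharMainConjOnTree`) on the two-variable road of HOME/bsd-eis-ky-MEMO-1.md
R2 (vi)/R4; HOME/k5-ty-g2/RUBIN-ROAD-DRUNG-SPEC.md. D-0026: ONE new named PUBLISHED fact, no `sorry`.

References: [Hida2010MuInvariant] Thm. I (p. 45), Thm. 5.1 (p. 123) / Lemma 5.2 (p. 128: (V) ⟺ (M1)–(M3)),
§1 (1.3) p. 44 (the measure, branch, `Γ⁻`); [CastellaGrossiLeeSkinner2022] proof of Thm. 1.2.2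
(TeX L646–648), proof of Thm. 2.2.2 (L1132), Thm. 2.1.2; [KellerYin2024] Thm. 1.2.2 (L676–683);
[Finis2006] (Hida p. 46; not used); cell `bsd-eis` LIT-DOSSIER §17 (a).
-/

set_option autoImplicit false

noncomputable section

open scoped Classical

open NumberField IsDedekindDomain Field
  Literature.NumberTheory.EllipticCurves Literature.NumberTheory.EllipticCurves.KellerYin2024
  Literature.NumberTheory.EllipticCurves.CastellaGrossiLeeSkinner2022
  Literature.NumberTheory.GaloisRepresentations

namespace Literature.NumberTheory.EllipticCurves.Hida2010MuInvariant

/-- **Hida 2010, Theorem I (anticyclotomic `μ = 0`), for the Katz `p`-adic `L`-function `𝓛_θ` of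
CGLS Thm. 2.1.2** — named fact. For `p` odd, `K` imaginary quadratic with `p = v v̄` split (`D_K` odd,
`≠ −3`), the anticyclotomic `ℤ_p`-extension `κ` with generator `γ`, a Teichmüller-valued character
`θ : G_ℚ → GL₁(ℤ_p)` unramified outside a Heegner integer `C` (Hida's `ℑ = 1`: every prime of the
branch conductor lies over a prime split in `K`) and at `p` (`p ∤ C`), its Hecke character `θ_K`
(`IsHeckeCharOf`, arithmetic reciprocity), and EVERY Katz frame `(Ω_K ≠ 0, Ω_p ∈ R₀^×, L ∈ R₀⟦T⟧)`
with `IsKatzLFunction ι' v v̄ Cbar κ γ θ_K Ω_K Ω_p L` (`Cbar` places where `θ_K` ramifies): `μ(L) = 0`,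
i.e. some coefficient of `L` is a unit of `R₀` — `∃ n, FirstUnitCoeffAt L n`. Print: "Suppose that
`p > 2` and that `p` is unramified in `F/ℚ`. Further suppose that `ℑ = 1`. Then the `μ`-invariant of
`φ⁻_ψ` vanishes, unless (V) is satisfied", (V) ⟺ (M1) ∧ (M2) ∧ (M3) (Lemma 5.2) with (M1) "`M/F` is
unramified at every finite place" — false for `M/F = K/ℚ`, so the vanishing is unconditional here;
`φ⁻_{θ_K}` is CGLS's `𝓛_θ` by CGLS's own usage (proofs of Thms. 1.2.2 and 2.2.2). See the module
docstring for the ∀-frame phrasing. PUBLISHED.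
[cite: Hida2010MuInvariant, Thm. I (p. 45) with Lemma 5.2 (p. 128: (V) ⟺ (M1)–(M3)) and §1 (1.3)–branch definitions (p. 44)]
[cite: CastellaGrossiLeeSkinner2022, proof of Thm. 1.2.2 (arXiv:2008.02571v2 TeX L646–648) and proof of Thm. 2.2.2 (L1132): "Hida's result [hidamu=0]" for these 𝓛_θ]
[cite: KellerYin2024, Thm. 1.2.2 (`Rubin Hida`, arXiv:2402.12781v2 TeX L676–683)] -/
def thmI_mu_katzLFunction_eq_zero : Prop :=
  ∀ (p : ℕ) [Fact p.Prime], 2 < p →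
    ∀ (K : Type) [Field K] [NumberField K], IsImaginaryQuadratic K →
      SatisfiesHeegnerHypothesis p K → Odd (NumberField.discr K) → NumberField.discr K ≠ -3 →
    ∀ (ι : K →+* ℚ_[p]) (v vbar : HeightOneSpectrum (𝓞 K)),
      (∀ x : 𝓞 K, x ∈ v.asIdeal ↔ ‖ι (x : K)‖ < 1) →
      ((p : ℕ) : 𝓞 K) ∈ vbar.asIdeal → vbar ≠ v →
    ∀ (κ : ZpExtension K p), κ.IsAnticyclotomic →
    ∀ (γ : absoluteGaloisGroup K) [Fact (κ.IsTopGenerator γ)],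
    ∀ (ι' : PadicAlgCl p ≃+* ℂ),
      (∀ (w : InfinitePlace K) (k : 𝓞 K), k ∈ v.asIdeal ↔ ‖ι'.symm (w.embedding (k : K))‖ < 1) →
    ∀ (θ : FramedGaloisRep ℚ (padicCoeffIntegers (∅ : Set (PadicAlgCl p))) 1),
      (∀ σ : absoluteGaloisGroup ℚ, θ σ ^ (p - 1) = 1) →
    ∀ (C : ℕ), SatisfiesHeegnerHypothesis C K →
      (∀ u : HeightOneSpectrum (𝓞 ℚ), ((C : ℤ) : 𝓞 ℚ) ∉ u.asIdeal → θ.IsUnramifiedAt u) →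
      (∀ u : HeightOneSpectrum (𝓞 ℚ), ((p : ℕ) : 𝓞 ℚ) ∈ u.asIdeal → θ.IsUnramifiedAt u) →
    ∀ (θK : HeckeCharacter K), IsHeckeCharOf ι' (θ.restrictField K) θK →
    ∀ (Cbar : Finset (HeightOneSpectrum (𝓞 K))), (∀ u ∈ Cbar, ¬ θK.IsUnramifiedAt u) →
    ∀ (ΩK : ℂ) (Ωp : (unrIntegers p)ˣ) (L : UnrSeries p), ΩK ≠ 0 →
      IsKatzLFunction ι' v vbar Cbar κ γ θK ΩK ((Ωp : unrIntegers p) : ℂ_[p]) L →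
    ∃ n : ℕ, FirstUnitCoeffAt L n

end Literature.NumberTheory.EllipticCurves.Hida2010MuInvariant

end
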